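import Literature.NumberTheory.Automorphic.KirillovToFirstMomentGL2
import Literature.NumberTheory.Automorphic.PairLFunctionPolesGLOneDedekindProofs
import HarnessLib

/-!
# Arthur–Clozel (2.3) in ranks `n ≤ 2`

Topic `NumberTheory/Automorphic`; namespace `Literature.NumberTheory.Automorphic`. Theorems only. The
named fact `JacquetShalika1981_partialPairL_pole_of_eq_conj` (`PairLFunctionPoles`; Arthur–Clozel
(1989), Ch. 3 §2 (2.3), p. 171: for unitary cuspidal `π ≅ σ̃`, `lim_{s → 1⁺} (s-1) L^S(s, π ⊗ σ)`
exists, finite and non-zero) in all ranks `n ≤ 2`: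

* rank `0` is excluded by the fact's binder `0 < n`;
* rank `1` is `JacquetShalika1981_partialPairL_pole_of_eq_conj_one` (`PairLFunctionPolesGLOneDedekindProofs`:
  the pole of the partial Dedekind zeta function);
* rank `2` is `JacquetShalika1981_partialPairL_pole_of_eq_conj_holds_two` (`KirillovToFirstMomentGL2`:
  the global Rankin–Selberg method of the tree completed by the Kirillov `L²`-bound of
  Jacquet–Shalika (1981), §4–§5).

The general rank requires the local theory of Jacquet–Shalika I, §1 and §3 (Prop. (3.17)), not in
the tree; this is the input `h23F₂` of
`ArthurClozelCuspidalDescentHeckeCharacters.jacquetShalika_le_two_of_rank_one_two`.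

## References

* J. Arthur, L. Clozel, *Simple algebras, base change, and the advanced theory of the trace formula*,
  Ann. of Math. Stud. 120 (1989), Ch. 3 §2, (2.3), p. 171 [ArthurClozelAMS120].
* H. Jacquet, J. A. Shalika, Amer. J. Math. 103 (1981), 499–558 and 777–815 [JacquetShalikaAJM1981].
-/

noncomputable section

open MeasureTheory

namespace Literature.NumberTheory.Automorphic

variable {n : ℕ} {K : Type} [Field K] [NumberField K]
variable {μ : Measure (AdelicGroupData.gl n K).automorphicQuotient} [(AdelicGroupData.gl n K).IsAutomorphicMeasure μ]

/-- **Arthur–Clozel (2.3) for `GL_n`, `n ≤ 2`.** [cite: ArthurClozelAMS120, Ch. 3 §2, (2.3), p. 171] -/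
theorem JacquetShalika1981_partialPairL_pole_of_eq_conj_holds_of_le_two (hn : n ≤ 2) :
    JacquetShalika1981_partialPairL_pole_of_eq_conj (n := n) (K := K) (μ := μ) := by
  interval_cases n
  · intro hn0
    exact absurd hn0 (lt_irrefl 0)
  · exact JacquetShalika1981_partialPairL_pole_of_eq_conj_one
  · exact JacquetShalika1981_partialPairL_pole_of_eq_conj_holds_two

end Literature.NumberTheory.Automorphic
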